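import Literature.Computability.QuantumComplexity.GuidedPauliBQPHardness
import Literature.Computability.Complexity.PromiseBPPClosureProofs
import Literature.Computability.Complexity.PromiseZPPProofs
import HarnessLib

/-!
# BQP-hardness of sparse well-conditioned matrix inversion (Harrow–Hassidim–Lloyd 2009, Thm 4)

The *un-dequantizable residue* of the dequantization census: Harrow, Hassidim, Lloyd, *Quantum
algorithm for linear systems of equations*, Phys. Rev. Lett. 103:150502 (2009) = arXiv:0811.3171
(held text `paper:arxiv-0811.3171`), §"Optimality" (suppl. §5), verbatim:

> We say that an algorithm solves matrix inversion if its input and output are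
> * Input: An `O(1)`-sparse matrix `A` specified either via an oracle or via a
>   `poly(log(N))`-time algorithm that returns the nonzero elements in a row.
> * Output: A bit that equals one with probability `⟨x|M|x⟩ ± ε`, where `M = |0⟩⟨0| ⊗ I_{N/2}`
>   corresponds to measuring the first qubit and `|x⟩` is a normalized state proportional to
>   `A⁻¹|b⟩` for `|b⟩ = |0⟩`.
> Further we demand that `A` is Hermitian and `κ⁻¹I ≤ A ≤ I`. We take `ε` to be a fixed constant,
> such as `1/100` […]. If the algorithm works when `A` is specified by an oracle, we say that it
> is relativizing.
>
> **Theorem 4.** (1) If a quantum algorithm exists for matrix inversion running in time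
> `κ^{1−δ}·poly log(N)` for some `δ > 0`, then `BQP = PSPACE`. (2) No relativizing quantum
> algorithm can run in time `κ^{1−δ}·poly log(N)`. (3) If a classical algorithm exists for matrix
> inversion running in time `poly(κ, log N)`, then `BPP = BQP`.
>
> *Proof of (3) and the construction (ibid.):* "Given an `n`-qubit `T`-gate quantum computation,
> define `U` as in (feynman-unitary) [`U = Σ_t |t+1⟩⟨t| ⊗ U_t` on a clock of `3T` steps, the last
> third uncomputing, so `U^{3T} = I`]. Define `A = [0, I − Ue^{−1/T}; I − U†e^{−1/T}, 0]`. Note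
> that `A` is Hermitian, has condition number `κ ≤ 2T` and dimension `N = 6T2ⁿ`. […]
> `(I − Ue^{−1/T})⁻¹ = Σ_{k≥0} U^k e^{−k/T}` […] As `Pr(T+1 ≤ k ≤ 2T) = e^{−2}/(1+e^{−2}+e^{−4})`
> and is independent of the result of the measurement `M` […] define `B`, `B̃`,
> `C = [0, B̃; B̃†, 0]` [so that] measuring the first qubit of `|y⟩`, `Cy = (b, 0)`, would
> correspond to perform `M₀` on `|x⟩`. The condition number of `C` is equal to that of `A`, but
> the dimension is now `N = 18T2ⁿ`. […] The proof of part 3 simply formulates a `poly(n)`-time,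
> `n`-qubit quantum computation as a `κ = poly(n)`, `N = 2ⁿ·poly(n)` matrix inversion problem
> and applies the classical algorithm which we have assumed exists."

So the printed content of (3) is a polynomial-time many-one reduction of every `BQP` computation
to the DECISION form of matrix inversion ("is the first-qubit weight of `A⁻¹|0⟩` at least `b` or
at most `a`", constant gap), i.e. BQP-HARDNESS of that promise problem; (3) itself is then one
line (a promise-`BPP` decider for a `BQP`-hard promise problem puts `BQP` inside `BPP`), which we
PROVE below from the tree's closure of promise-`BPP` under Karp reductions
(`PromiseProblem.mem_PromiseBPP'_of_polyTimeReducible_holds`) and `ofLanguage L ∈ PromiseBPP' ↔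
L ∈ BPP` (`ofLanguage_mem_PromiseBPP'_iff`).

This file vendors the hardness statement as ONE named fact,
`HarrowHassidimLloyd2009_matrixInversion_bqpHard`, on an explicit instance format that REUSES
the weighted-Pauli-list format of `GuidedPauliHamiltonian.lean` (`GuidedPauliTerm`,
`guidedPauliHamiltonian`, the `Bool` encoding combinators), exactly as
`GuidedPauliBQPHardness.lean` transcribes [GharibianLegall2022, Thm 2].  Format and deltas from
the printed box (each stated so that a reviewer checks the transcription, not the theorem):

* an instance is `⟨n, (terms, (α, (β, D)))⟩ : MatrixInversionInstance` — a qubit number `n`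
  (`N = 2ⁿ`), a list of weighted Pauli terms `((p,q),(x,z)) ↦ (p + q√2) • ⊗ᵢ σ(xᵢ,zᵢ)` whose sum
  `A = guidedPauliHamiltonian terms` IS the input matrix, and rational thresholds `a = α/(D+1)`,
  `b = β/(D+1)`.  Delta (i), INPUT CONVENTION: a length-`m` Pauli list is an `m`-row-sparse
  matrix whose non-zero row entries are computable in `poly(n, m)` time from the list, so this
  is a SUB-format of the printed "poly(log N)-time row algorithm" convention (with sparsity
  `poly(n)` rather than `O(1)`: the printed hard instances have `O(1)`-sparse rows, and a Pauli
  list of the clock construction has `poly(T)` terms — hardness for the sub-format is what the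
  printed reduction gives once its instances are written as Pauli lists, see delta (iv)); the
  oracle ("relativizing") convention of Theorems 4(2) and 5 is NOT typed here
  (`-- TODO(general form)`: oracle-access matrix inversion over the query trees of
  `Literature/Barriers/QuantumAdvantage/QICLinearSystemsLowerBound.lean`).
* Delta (ii), NORMALISATION AND SIGN: the printed `κ⁻¹I ≤ A ≤ I` is replaced by the
  scale-invariant two-sided bound `σ²‖v‖² ≤ ‖Av‖² ≤ (g(n)σ)²‖v‖²` for some `σ > 0`
  (`IsConditioned`: all singular values within ratio `g(n)`; `A` is automatically Hermitian —
  real weights on Hermitian Pauli strings, `isHermitian_guidedPauliHamiltonian`).  The printed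
  hard instances `A`, `C` are Hermitian INDEFINITE dilations `[0, B; B†, 0]`, so "`κ⁻¹I ≤ A ≤ I`"
  can only be read as a singular-value window, which is what we type; the overall scale is free
  because the output statistic depends on the direction of `A⁻¹|0⟩` only.  The condition-number
  schedule is `g(n) = n^c + c` (`κ = poly`, as in (3) and in `guidedPauliHamiltonianProblem'`).
* Delta (iii), OUTPUT: the printed output is a coin with bias `⟨x|M|x⟩ ± ε`, `ε` a fixed constant,
  `M` = "first qubit is `0`".  We type the induced gapped DECISION problem: YES iff the
  first-qubit-zero weight of `x = A⁻¹|0ⁿ⟩` is `≥ b‖x‖²`, NO iff `≤ a‖x‖²`, with a promise gap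
  `b − a ≥ 1/G` for a CONSTANT `G` (problem parameter; the printed gap is the constant
  `e^{−2}/(3(1+e^{−2}+e^{−4}))` times the `BQP` gap `1/3`).  `|b⟩ = |0⟩` is the all-zero basis
  ket `zeroKet`.
* Delta (iv), WEIGHT RING: weights are `p + q√2 ∈ ℤ[√2]` (the format's).  For the tree's `BQP`
  (Clifford+T, `Literature.Computability.Cryptography.BQP`) the gates `U_t` have entries in
  `2^{−r}ℤ[i, √2]`, the clock operators `|t+1⟩⟨t|` on a binary register are sums of `poly(T)`
  Pauli strings with coefficients in `2^{−ℓ}{±1, ±i}`, and the Pauli coefficients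
  `2^{−n'}Tr(P·C)` of the Hermitian dilation are REAL, hence in `2^{−r'}ℤ[√2]`; one global integer
  rescaling puts them in `ℤ[√2]` (harmless by delta (ii)).  The one printed ingredient NOT in this
  ring is the damping `e^{−1/T}`: the printed argument uses of it only `0 < e^{−1/T} < 1`, the
  geometric series / periodicity `U^{3T} = I`, `κ ≤ 2/(1 − e^{−1/T}) ≤ 2T`-type bounds and that
  the window probability `Pr(T+1 ≤ k ≤ 2T)` is a constant independent of the computation; every
  one of these holds verbatim for a RATIONAL damping `r = 1 − 1/(2T)` (window probability again an
  explicit constant bounded below uniformly in `T`), which is the reading under which the fact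
  below is the printed theorem.  This is recorded as a transcription delta, not hidden.
* Delta (v), DIMENSION: `N = 18T·2ⁿ` is padded to a power of two by an identity block decoupled
  from `|0…0⟩` (changes neither `κ`, nor sparsity, nor the statistic).

Proved API: membership of explicit instances (`mk_mem_matrixInversionYesSet_iff`, `…NoSet_iff`);
uniqueness of the solution under the conditioning promise (`IsConditioned.solution_unique`);
the right-hand side is non-zero (`zeroKet_ne_zero`); YES ∩ NO = ∅ and the promise problem is
disjoint (`matrixInversionProblem_disjoint`); monotonicity in the gap parameter
(`matrixInversionYesSet_mono`, `isHard_matrixInversionProblem_mono`); and **Theorem 4(3) from the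
fact** (`HarrowHassidimLloyd2009_matrixInversion_bqpHard.bqp_subset_bpp`): if the hard matrix
inversion problem is in promise-`BPP`, then `BQP ⊆ BPP` (with `BPP ⊆ BQP`,
`BPP_subset_BQP_holds` elsewhere in the tree, this is `BPP = BQP`; by `BQPEqBPPIff.lean` that is
literally `¬ QuantumAdvantage` — the honest-framing anchor: dequantizing THIS row would decide
the summit, which no dequantization result in print claims).

Deliberately NOT here (no further named facts, D-0026): the quantum upper bound (HHL's algorithm,
`Õ(κ² log N/ε)`; membership in `PromiseBQP`), Theorem 4(1)–(2), Theorems 5–6 (relativized and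
precision lower bounds), and the Childs–Kothari–Somma / QSVT improvements.

## References
* [HarrowHassidimLloyd2009] A. W. Harrow, A. Hassidim, S. Lloyd, *Quantum algorithm for linear
  systems of equations*, Phys. Rev. Lett. 103 (2009) 150502, doi:10.1103/physrevlett.103.150502
  (arXiv:0811.3171v3, suppl. §5 "Optimality": definition of matrix inversion, Theorem 4 and its
  proof; held text pp. 12–13).
* [GharibianLegall2022] S. Gharibian, F. Le Gall, STOC 2022 (arXiv:2111.09079), §1.1 ("the HHL
  algorithm … is BQP-complete even for constant precision") — the census sentence this file types.
* [Goldreich2006] O. Goldreich, *On promise problems: a survey*, 2006, §1.2 (Karp reductions of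
  promise problems; closure of promise-BPP).

## Mathlib / tree search
`lean search 'BQP-complete|BQP-hard'` (2026-08-27): `GuidedPauliBQPHardness.lean` (format and
`PromiseProblem.IsHard.mono_right` reused), `JonesInBQP`/`JonesReduction*` (a different complete
problem); `matrix inversion`: only `LowRankMatrixInversion.lean` (the dequantized LOW-RANK regime,
CGLLTW Cor. 4.11, which quotes "Since sparse matrix inversion is BQP-complete, it is unlikely that
one can efficiently dequantize it").  Nothing on HHL's hardness theorem.
-/

noncomputable section

namespace Literature.Computability.QuantumComplexity

open Literature.Computability.Complexity Literature.Computability.Cryptography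

/-! ### Instances and their Boolean encoding -/

/-- The data of a matrix-inversion instance on `n` qubits: `(terms, (α, (β, D)))` — the weighted
Pauli terms of the input matrix `A` and the threshold data `a = α/(D+1)`, `b = β/(D+1)`.
[cite: HarrowHassidimLloyd2009, §Optimality (definition of matrix inversion)] -/
abbrev MatrixInversionData (n : ℕ) : Type :=
  List (GuidedPauliTerm n) × (ℤ × ℤ × ℕ)

/-- Instances of the matrix-inversion promise problem: `⟨n, (terms, (α, (β, D)))⟩`.
[cite: HarrowHassidimLloyd2009, §Optimality (definition of matrix inversion)] -/
abbrev MatrixInversionInstance : Type :=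
  Σ n : ℕ, MatrixInversionData n

/-- The Boolean encoding of instances (the list / pair / dependent-pair combinators of
`BoolEncodings.lean`, as in `guidedPauliEncoding`). [folklore] -/
def matrixInversionEncoding : _root_.Computability.Encoding MatrixInversionInstance Bool :=
  _root_.Computability.Encoding.sigmaBool (F := MatrixInversionData) fun n : ℕ =>
    (((encodingIntBool.pairBool encodingIntBool).pairBool
        ((encodingBitVec n).pairBool (encodingBitVec n))).listBool).pairBool
      (encodingIntBool.pairBool (encodingIntBool.pairBool _root_.Computability.encodingNatBool))

/-! ### The right-hand side, the conditioning promise and the output statistic -/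

variable {n : ℕ}

/-- The right-hand side `|b⟩ = |0⟩ = |0…0⟩`: the basis ket of the all-`false` string.
[cite: HarrowHassidimLloyd2009, §Optimality ("`|b⟩ = |0⟩`")] -/
def zeroKet (n : ℕ) : (Fin n → Bool) → ℂ :=
  fun y => if y = (fun _ => false) then 1 else 0

/-- The squared `ℓ²`-norm `Σ_y ‖v y‖²` of a vector on the `n`-qubit register. [folklore] -/
def ketNormSq (v : (Fin n → Bool) → ℂ) : ℝ := ∑ y, ‖v y‖ ^ 2

/-- The weight of `v` on the strings whose FIRST qubit is `0` (`false`): `⟨v|M|v⟩` for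
`M = |0⟩⟨0| ⊗ I_{N/2}` (for `n = 0` the condition is vacuous and this is `‖v‖²`).
[cite: HarrowHassidimLloyd2009, §Optimality ("`M = |0⟩⟨0| ⊗ I_{N/2}` corresponds to measuring the first qubit")] -/
def firstQubitZeroWeight (v : (Fin n → Bool) → ℂ) : ℝ :=
  ∑ y, if (∀ h : 0 < n, y ⟨0, h⟩ = false) then ‖v y‖ ^ 2 else 0

/-- The conditioning promise with ratio `K`: all singular values of `A` lie in a window
`[σ, Kσ]` for some `σ > 0`, i.e. `σ²‖v‖² ≤ ‖Av‖² ≤ (Kσ)²‖v‖²` for all `v` (scale-invariant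
reading of "`κ⁻¹I ≤ A ≤ I`", module docstring delta (ii)).
[cite: HarrowHassidimLloyd2009, §Optimality ("`κ⁻¹I ≤ A ≤ I`")] -/
def IsConditioned (K : ℝ) (A : Matrix (Fin n → Bool) (Fin n → Bool) ℂ) : Prop :=
  ∃ σ : ℝ, 0 < σ ∧ ∀ v : (Fin n → Bool) → ℂ,
    σ ^ 2 * ketNormSq v ≤ ketNormSq (A.mulVec v) ∧
      ketNormSq (A.mulVec v) ≤ (K * σ) ^ 2 * ketNormSq v

/-! ### The two sides of the promise -/

/-- YES data for condition-number schedule `g` and gap parameter `G`: `A` is `g(n)`-conditioned,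
the thresholds satisfy `(D+1) ≤ (β − α)·G` (gap `b − a ≥ 1/G`), and the solution `x` of
`Ax = |0…0⟩` has first-qubit-zero weight `≥ b‖x‖²`, `b = β/(D+1)`.
[cite: HarrowHassidimLloyd2009, §Optimality (definition) and Thm 4] -/
def IsMatrixInversionYes (g : ℕ → ℝ) (G : ℕ) (n : ℕ) (terms : List (GuidedPauliTerm n))
    (α β : ℤ) (D : ℕ) : Prop :=
  IsConditioned (g n) (guidedPauliHamiltonian terms) ∧
    ((D : ℝ) + 1) ≤ ((β : ℝ) - α) * G ∧
    ∃ x : (Fin n → Bool) → ℂ, (guidedPauliHamiltonian terms).mulVec x = zeroKet n ∧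
      (β : ℝ) * ketNormSq x ≤ ((D : ℝ) + 1) * firstQubitZeroWeight x

/-- NO data: as `IsMatrixInversionYes` but the solution has first-qubit-zero weight `≤ a‖x‖²`,
`a = α/(D+1)`. [cite: HarrowHassidimLloyd2009, §Optimality (definition) and Thm 4] -/
def IsMatrixInversionNo (g : ℕ → ℝ) (G : ℕ) (n : ℕ) (terms : List (GuidedPauliTerm n))
    (α β : ℤ) (D : ℕ) : Prop :=
  IsConditioned (g n) (guidedPauliHamiltonian terms) ∧
    ((D : ℝ) + 1) ≤ ((β : ℝ) - α) * G ∧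
    ∃ x : (Fin n → Bool) → ℂ, (guidedPauliHamiltonian terms).mulVec x = zeroKet n ∧
      ((D : ℝ) + 1) * firstQubitZeroWeight x ≤ (α : ℝ) * ketNormSq x

/-- The YES instances. [cite: HarrowHassidimLloyd2009, §Optimality and Thm 4] -/
def matrixInversionYesSet (g : ℕ → ℝ) (G : ℕ) : Set MatrixInversionInstance :=
  {I | ∃ (n : ℕ) (terms : List (GuidedPauliTerm n)) (α β : ℤ) (D : ℕ),
      I = ⟨n, (terms, (α, (β, D)))⟩ ∧ IsMatrixInversionYes g G n terms α β D}

/-- The NO instances. [cite: HarrowHassidimLloyd2009, §Optimality and Thm 4] -/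
def matrixInversionNoSet (g : ℕ → ℝ) (G : ℕ) : Set MatrixInversionInstance :=
  {I | ∃ (n : ℕ) (terms : List (GuidedPauliTerm n)) (α β : ℤ) (D : ℕ),
      I = ⟨n, (terms, (α, (β, D)))⟩ ∧ IsMatrixInversionNo g G n terms α β D}

/-! ### The promise problem and the named fact -/

/-- **Sparse well-conditioned matrix inversion, decision form** with condition-number schedule
`κ ≤ n^c + c` (`N = 2ⁿ`) and constant promise gap `≥ 1/G`: given a Pauli-list matrix `A` and
thresholds `a < b`, decide whether the first-qubit-zero weight of `A⁻¹|0ⁿ⟩` is `≥ b` (YES) or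
`≤ a` (NO) of its squared norm. [cite: HarrowHassidimLloyd2009, §Optimality and Thm 4] -/
def matrixInversionProblem (c G : ℕ) : PromiseProblem :=
  PromiseProblem.ofEncoding matrixInversionEncoding
    (matrixInversionYesSet (fun n => (n : ℝ) ^ c + c) G)
    (matrixInversionNoSet (fun n => (n : ℝ) ^ c + c) G)

/-- **Harrow–Hassidim–Lloyd, BQP-hardness of matrix inversion** (the content of Theorem 4(3),
transcribed onto the Pauli-list instance format with the deltas (i)–(v) of the module docstring):
for some condition-number exponent `c` and some constant gap parameter `G`, the matrix-inversion
promise problem `matrixInversionProblem c G` is `BQP`-hard under polynomial-time Karp reductions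
of promise problems.  As printed: "The proof of part 3 of Theorem 4 simply formulates a
`poly(n)`-time, `n`-qubit quantum computation as a `κ = poly(n)`, `N = 2ⁿ·poly(n)` matrix
inversion problem", via `C = [0, B̃; B̃†, 0]` with "condition number `κ ≤ 2T`" and "measuring the
first qubit of `|y⟩`".
[cite: HarrowHassidimLloyd2009, Thm 4(3) and its proof (§Optimality)] -/
def HarrowHassidimLloyd2009_matrixInversion_bqpHard : Prop :=
  ∃ c G : ℕ, (matrixInversionProblem c G).IsHard BQP

/-! ### Membership of explicit instances -/

/-- An explicit instance is a YES instance iff its data satisfies `IsMatrixInversionYes`.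
[cite: HarrowHassidimLloyd2009, §Optimality (definition of matrix inversion)] -/
theorem mk_mem_matrixInversionYesSet_iff {g : ℕ → ℝ} {G : ℕ} {terms : List (GuidedPauliTerm n)}
    {α β : ℤ} {D : ℕ} :
    (⟨n, (terms, (α, (β, D)))⟩ : MatrixInversionInstance) ∈ matrixInversionYesSet g G ↔
      IsMatrixInversionYes g G n terms α β D := by
  refine ⟨?_, fun h => ⟨n, terms, α, β, D, rfl, h⟩⟩
  rintro ⟨n', terms', α', β', D', ⟨⟩, h'⟩
  exact h'

/-- An explicit instance is a NO instance iff its data satisfies `IsMatrixInversionNo`.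
[cite: HarrowHassidimLloyd2009, §Optimality (definition of matrix inversion)] -/
theorem mk_mem_matrixInversionNoSet_iff {g : ℕ → ℝ} {G : ℕ} {terms : List (GuidedPauliTerm n)}
    {α β : ℤ} {D : ℕ} :
    (⟨n, (terms, (α, (β, D)))⟩ : MatrixInversionInstance) ∈ matrixInversionNoSet g G ↔
      IsMatrixInversionNo g G n terms α β D := by
  refine ⟨?_, fun h => ⟨n, terms, α, β, D, rfl, h⟩⟩
  rintro ⟨n', terms', α', β', D', ⟨⟩, h'⟩
  exact h'

/-! ### Elementary facts: the norm, the right-hand side, uniqueness of the solution -/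

/-- `‖v‖² ≥ 0`. [folklore] -/
private theorem ketNormSq_nonneg (v : (Fin n → Bool) → ℂ) : 0 ≤ ketNormSq v :=
  Finset.sum_nonneg fun y _ => pow_nonneg (norm_nonneg (v y)) 2

/-- `‖v‖² = 0 ↔ v = 0`. [folklore] -/
private theorem ketNormSq_eq_zero_iff (v : (Fin n → Bool) → ℂ) : ketNormSq v = 0 ↔ v = 0 := by
  constructor
  · intro h
    have h' := (Finset.sum_eq_zero_iff_of_nonneg fun y _ => pow_nonneg (norm_nonneg (v y)) 2).1 h
    funext y
    have := h' y (Finset.mem_univ y)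
    simpa using this
  · rintro rfl
    simp [ketNormSq]

/-- `‖0‖² = 0`. [folklore] -/
@[simp] private theorem ketNormSq_zero : ketNormSq (0 : (Fin n → Bool) → ℂ) = 0 := by
  simp [ketNormSq]

/-- `|0…0⟩ ≠ 0` (its amplitude at the all-`false` string is `1`).
[cite: HarrowHassidimLloyd2009, §Optimality ("`|b⟩ = |0⟩`")] -/
theorem zeroKet_ne_zero (n : ℕ) : zeroKet n ≠ 0 := by
  intro h
  have := congrFun h (fun _ => false)
  simp [zeroKet] at this

/-- Under the conditioning promise the kernel of `A` is trivial ("`κ⁻¹I ≤ A`": `A` is invertible).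
[cite: HarrowHassidimLloyd2009, §Optimality ("`κ⁻¹I ≤ A ≤ I`")] -/
theorem IsConditioned.eq_zero_of_mulVec_eq_zero {K : ℝ} {A : Matrix (Fin n → Bool) (Fin n → Bool) ℂ}
    (hA : IsConditioned K A) {v : (Fin n → Bool) → ℂ} (hv : A.mulVec v = 0) : v = 0 := by
  obtain ⟨σ, hσ, h⟩ := hA
  have h1 := (h v).1
  rw [hv, ketNormSq_zero] at h1
  have h2 : ketNormSq v ≤ 0 := by
    refine le_of_not_gt fun hlt => ?_
    have : 0 < σ ^ 2 * ketNormSq v := mul_pos (pow_pos hσ 2) hlt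
    linarith
  exact (ketNormSq_eq_zero_iff v).1 (le_antisymm h2 (ketNormSq_nonneg v))

/-- Under the conditioning promise the linear system `Ax = b` has at most one solution, so
"`|x⟩` proportional to `A⁻¹|b⟩`" is well defined. [cite: HarrowHassidimLloyd2009, §Optimality ("`κ⁻¹I ≤ A ≤ I`", "`A⁻¹|b⟩`")] -/
theorem IsConditioned.solution_unique {K : ℝ} {A : Matrix (Fin n → Bool) (Fin n → Bool) ℂ}
    (hA : IsConditioned K A) {b x x' : (Fin n → Bool) → ℂ} (hx : A.mulVec x = b)
    (hx' : A.mulVec x' = b) : x = x' := by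
  have h : A.mulVec (x - x') = 0 := by rw [Matrix.mulVec_sub, hx, hx', sub_self]
  exact sub_eq_zero.1 (hA.eq_zero_of_mulVec_eq_zero h)

/-! ### Disjointness of the promise -/

/-- YES data and NO data are incompatible when the gap parameter is positive: the unique solution
`x ≠ 0` would satisfy `b‖x‖² ≤ ⟨x|M|x⟩ ≤ a‖x‖²` with `a < b`.
[cite: HarrowHassidimLloyd2009, §Optimality (definition of matrix inversion)] -/
theorem IsMatrixInversionYes.not_isMatrixInversionNo {g : ℕ → ℝ} {G : ℕ}
    {terms : List (GuidedPauliTerm n)} {α β : ℤ} {D : ℕ}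
    (hyes : IsMatrixInversionYes g G n terms α β D) : ¬ IsMatrixInversionNo g G n terms α β D := by
  rintro ⟨_, _, x', hx', hno⟩
  obtain ⟨hcond, hgap, x, hx, hyesx⟩ := hyes
  have hxx' : x' = x := hcond.solution_unique hx' hx
  subst hxx'
  have hxne : x' ≠ 0 := by
    rintro rfl
    exact zeroKet_ne_zero n (by rw [← hx', Matrix.mulVec_zero])
  have hpos : 0 < ketNormSq x' :=
    lt_of_le_of_ne (ketNormSq_nonneg x') (fun h => hxne ((ketNormSq_eq_zero_iff x').1 h.symm))
  have hD : (0 : ℝ) < (D : ℝ) + 1 := by positivity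
  -- gap: (β - α) * G ≥ D + 1 > 0 forces α < β
  have hαβ : (α : ℝ) < β := by
    refine lt_of_not_ge fun hle => ?_
    have : ((β : ℝ) - α) * G ≤ 0 :=
      mul_nonpos_of_nonpos_of_nonneg (sub_nonpos.2 hle) (Nat.cast_nonneg G)
    linarith
  -- chain: β‖x‖² ≤ (D+1) W ≤ α‖x‖²
  have hchain : (β : ℝ) * ketNormSq x' ≤ (α : ℝ) * ketNormSq x' := le_trans hyesx hno
  have : ((β : ℝ) - α) * ketNormSq x' ≤ 0 := by linarith
  have : 0 < ((β : ℝ) - α) * ketNormSq x' := mul_pos (sub_pos.2 hαβ) hpos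
  linarith

/-- YES ∩ NO = ∅. [cite: HarrowHassidimLloyd2009, §Optimality (definition of matrix inversion)] -/
theorem disjoint_matrixInversionYesSet_matrixInversionNoSet (g : ℕ → ℝ) (G : ℕ) :
    _root_.Disjoint (matrixInversionYesSet g G) (matrixInversionNoSet g G) := by
  refine Set.disjoint_left.2 ?_
  rintro ⟨n, terms, α, β, D⟩ hyes hno
  rw [mk_mem_matrixInversionYesSet_iff] at hyes
  rw [mk_mem_matrixInversionNoSet_iff] at hno
  exact hyes.not_isMatrixInversionNo hno

/-- The matrix-inversion promise problem is disjoint. [cite: HarrowHassidimLloyd2009, §Optimality (definition of matrix inversion)] -/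
theorem matrixInversionProblem_disjoint (c G : ℕ) : (matrixInversionProblem c G).Disjoint :=
  PromiseProblem.disjoint_ofEncoding _ (disjoint_matrixInversionYesSet_matrixInversionNoSet _ G)

/-! ### Monotonicity in the gap parameter (proved; makes the fact usable at any larger `G`) -/

/-- YES data is monotone in the gap parameter ("`ε` … a fixed constant": any smaller constant
gap is admissible). [cite: HarrowHassidimLloyd2009, §Optimality ("We take `ε` to be a fixed constant")] -/
theorem IsMatrixInversionYes.mono {g : ℕ → ℝ} {G G' : ℕ} (hGG' : G ≤ G')
    {terms : List (GuidedPauliTerm n)} {α β : ℤ} {D : ℕ}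
    (h : IsMatrixInversionYes g G n terms α β D) : IsMatrixInversionYes g G' n terms α β D := by
  obtain ⟨hcond, hgap, x, hx, hw⟩ := h
  refine ⟨hcond, ?_, x, hx, hw⟩
  have hD : (0 : ℝ) < (D : ℝ) + 1 := by positivity
  have hβα : 0 ≤ (β : ℝ) - α := by
    refine le_of_not_gt fun hlt => ?_
    have : ((β : ℝ) - α) * G ≤ 0 := mul_nonpos_of_nonpos_of_nonneg hlt.le (Nat.cast_nonneg G)
    linarith
  exact le_trans hgap (mul_le_mul_of_nonneg_left (Nat.cast_le.2 hGG') hβα)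

/-- NO data is monotone in the gap parameter. [cite: HarrowHassidimLloyd2009, §Optimality ("We take `ε` to be a fixed constant")] -/
theorem IsMatrixInversionNo.mono {g : ℕ → ℝ} {G G' : ℕ} (hGG' : G ≤ G')
    {terms : List (GuidedPauliTerm n)} {α β : ℤ} {D : ℕ}
    (h : IsMatrixInversionNo g G n terms α β D) : IsMatrixInversionNo g G' n terms α β D := by
  obtain ⟨hcond, hgap, x, hx, hw⟩ := h
  refine ⟨hcond, ?_, x, hx, hw⟩
  have hD : (0 : ℝ) < (D : ℝ) + 1 := by positivity
  have hβα : 0 ≤ (β : ℝ) - α := by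
    refine le_of_not_gt fun hlt => ?_
    have : ((β : ℝ) - α) * G ≤ 0 := mul_nonpos_of_nonpos_of_nonneg hlt.le (Nat.cast_nonneg G)
    linarith
  exact le_trans hgap (mul_le_mul_of_nonneg_left (Nat.cast_le.2 hGG') hβα)

/-- The YES set grows with the gap parameter. [cite: HarrowHassidimLloyd2009, §Optimality ("We take `ε` to be a fixed constant")] -/
theorem matrixInversionYesSet_mono (g : ℕ → ℝ) {G G' : ℕ} (hGG' : G ≤ G') :
    matrixInversionYesSet g G ⊆ matrixInversionYesSet g G' := by
  rintro I ⟨n, terms, α, β, D, rfl, h⟩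
  exact ⟨n, terms, α, β, D, rfl, h.mono hGG'⟩

/-- The NO set grows with the gap parameter. [cite: HarrowHassidimLloyd2009, §Optimality ("We take `ε` to be a fixed constant")] -/
theorem matrixInversionNoSet_mono (g : ℕ → ℝ) {G G' : ℕ} (hGG' : G ≤ G') :
    matrixInversionNoSet g G ⊆ matrixInversionNoSet g G' := by
  rintro I ⟨n, terms, α, β, D, rfl, h⟩
  exact ⟨n, terms, α, β, D, rfl, h.mono hGG'⟩

/-- Hardness transfers to any larger gap parameter (both instance sets grow), so the fact gives
hardness for every `G' ≥ G`. [cite: HarrowHassidimLloyd2009, Thm 4(3) (with §Optimality, "`ε` … a fixed constant")] -/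
theorem isHard_matrixInversionProblem_mono {C : Set (Language Bool)} {c G G' : ℕ} (hGG' : G ≤ G')
    (h : (matrixInversionProblem c G).IsHard C) : (matrixInversionProblem c G').IsHard C :=
  h.mono_right (Computability.Encoding.toLanguage_mono _ (matrixInversionYesSet_mono _ hGG'))
    (Computability.Encoding.toLanguage_mono _ (matrixInversionNoSet_mono _ hGG'))

/-! ### Theorem 4(3) from the fact (proved): a classical decider collapses `BQP` into `BPP` -/

/-- **Harrow–Hassidim–Lloyd, Theorem 4(3), from the hardness fact.**  If the `BQP`-hard
matrix-inversion promise problem is decided in promise-`BPP` (the tree's textbook class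
`PromiseBPP'`) — in particular if "a classical algorithm exists for matrix inversion running in
time `poly(κ, log N)`" for Pauli-list inputs — then `BQP ⊆ BPP` (hence `BPP = BQP` with
`BPP_subset_BQP_holds`).  Proof: closure of promise-`BPP` under Karp reductions
(`mem_PromiseBPP'_of_polyTimeReducible_holds`) and `ofLanguage L ∈ PromiseBPP' ↔ L ∈ BPP`.
[cite: HarrowHassidimLloyd2009, Thm 4(3)] -/
theorem HarrowHassidimLloyd2009_matrixInversion_bqpHard.bqp_subset_bpp
    (hHHL : HarrowHassidimLloyd2009_matrixInversion_bqpHard)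
    (hdec : ∀ c G : ℕ, matrixInversionProblem c G ∈ PromiseBPP') : BQP ⊆ BPP := by
  obtain ⟨c, G, hhard⟩ := hHHL
  intro L hL
  have hred : (PromiseProblem.ofLanguage L).PolyTimeReducible (matrixInversionProblem c G) :=
    hhard L hL
  have hmem : PromiseProblem.ofLanguage L ∈ PromiseBPP' :=
    PromiseProblem.mem_PromiseBPP'_of_polyTimeReducible_holds _ _ hred (hdec c G)
  exact ofLanguage_mem_PromiseBPP'_iff.1 hmem

end Literature.Computability.QuantumComplexity
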